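import Literature.NumberTheory.Automorphic.UnitaryGroupSingularClassLogFormCM
import Literature.NumberTheory.Automorphic.UnitaryGroupSingularBorelClass
import Literature.NumberTheory.Automorphic.UnitaryGroupTruncatedTraceClassKeyedSocketGlue
import Literature.NumberTheory.Automorphic.UnitaryGroupSingularOrbitalTermCM
import HarnessLib

/-!
# The singular socket of the trace formula for the quasi-split `U(J₃)` of a CM field, CLOSED on a finite set of classes:
# `Σ_{i ∈ S, i singular} p_i(0) = Σ_i 𝔅_i`
(Rogawski, *Automorphic Representations of Unitary Groups in Three Variables* (1990), Prop. 7.2.2 and (7.2.3) (pp. 91–95): the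
term `J^T_𝔬(f)` of a class `𝔬 ∋ d(a, b, a)`, `a ≠ b ∈ E¹`, is `𝔄·log T + 𝔅` for `T ≫ 0`; Arthur, *The trace formula in invariant
form*, Ann. of Math. 114 (1981), Prop. 2.3: `J^T_𝔬(f)` is a polynomial in `log T` and `J_𝔬(f)` its constant term.)

Topic `NumberTheory/Automorphic`; namespace `Literature.NumberTheory.Automorphic.UnitaryGroup`. THEOREMS ONLY over accepted tree
modules (no definition, no named fact, no instance, no notation, no `sorry`). Item (σ-ii) «FINSET CLOSER OF THE SINGULAR SOCKET» of
the T1-qs LAW 5 road of `Cruxes/H413/Lines/F0_T1InnerFormTraceIdentity.lean` (cell `pub/hodgecm-mathlib`, crux H413). The socket ★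
`arthurTrace_eq_sum_orbital_add_sum_central_add_sum_singular_add_sum_hyperbolic_cm` (`UnitaryGroupArthurTraceThreeSockets`) writes
`J(f)` with a sum `Σ_{i ∈ S♭_f.filter singular} p_i(0)` over the refined classes `i = (((X − a)²(X − b)) ⊗ 𝔸_L, true)`, `a ≠ b ∈ L¹`.
The per-class head ★ `truncatedTraceClass_singular_eq_mul_log_add_cm` (`UnitaryGroupSingularClassLogFormCM`, A-p14) gives, for EACH
such pair with rational representative `g₀ = d(a, b, a)` (★ `exists_rational_eq_singularNormalForm`) and GIVEN the integrability
`hS` of the orbital sum of `γ₀ = ι(g₀)` over `X`, constants `𝔄, 𝔅` and a threshold with `J^T_i(f) = 𝔄·log T + 𝔅`. This file is the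
bookkeeping that closes the SOCKET, by ★ KEYED GLUE `exists_rep_const_sum_classPolynomial_eval_zero_eq`
(`UnitaryGroupTruncatedTraceClassKeyedSocketGlue`) at the key type `Lˣ × Lˣ` (constants `(𝔄, 𝔅) : ℂ × ℂ` behind the key), the
fibre letters being automatic (the head is stated for the refined class map `cl♭` literally). The letter `hS` is carried
UNIFORMLY over the filter (one hypothesis quantified over `a, b, g₀`); the constants `𝔅_i` are the head's (existential) ones — the
explicit log form is ★ `UnitaryGroupSingularTermLogForm`.

* §1 **`exists_units_of_mem_filter_singular`** (generic quadratic `(F, E, c)`): a class of the singular filter has a key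
  `(a, b)`, `a ≠ b ∈ E¹`, with `i = (((X − a)²(X − b)) ⊗ 𝔸_E, true)`; **`exists_rational_eq_singularDiagonal`**: `d(a, b, a) ∈ G(F)`.
* §2 **`exists_rep_sum_filter_singular_classPolynomial_eval_zero_cm`** (CM pin): keys `srep : _ → Lˣ × Lˣ` and constants
  `cst : _ → ℂ × ℂ` on the singular filter with the key relations, `P i = C (cst i).1 * X + C (cst i).2` and
  **`Σ_{S.filter singular} (P i).eval 0 = Σ_{S.filter singular} (cst i).2`**; §3 **`exists_keyrep_sum_filter_singular_classPolynomial_eval_zero_cm`**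
  — the same with key and constants PAIRED: literally the `closerS` hypothesis of ★
  `arthurTrace_eq_orbital_add_central_add_singular_add_hyperbolic_of_closers` (`UnitaryGroupArthurTraceThreeSocketsClosed`) at
  `κs := (Lˣ × Lˣ) × (ℂ × ℂ)`, `Bs p := p.2.2`.

## References

* J. D. Rogawski, *Automorphic Representations of Unitary Groups in Three Variables*, Annals of Mathematics Studies 123 (1990),
  Prop. 7.2.2, (7.2.3) (pp. 91–95), §2.2–2.3 (pp. 13–14) [Rogawski1990].
* J. Arthur, *The trace formula in invariant form*, Ann. of Math. 114 (1981), Prop. 2.3 [Arthur1981TraceFormulaInvariantForm].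
-/

set_option autoImplicit false

noncomputable section

open MeasureTheory MeasureTheory.Measure NumberField IsDedekindDomain Set Filter Polynomial Function Literature.MeasureTheory.Group
open scoped ENNReal NNReal MatrixGroups Classical

namespace Literature.NumberTheory.Automorphic

namespace UnitaryGroup

/-! ## §1 Keys and representatives of the singular classes -/

section Key

variable {F E : Type} [Field F] [NumberField F] [Field E] [NumberField E] [Algebra F E] {c : E ≃ₐ[F] E}

omit [NumberField F] in
/-- **EVERY CLASS OF THE SINGULAR SOCKET HAS A KEY `(a, b)`, `a ≠ b ∈ E¹`.** If the refined index `i = (p, flag)` lies in the singular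
filter of ★ `arthurTrace_eq_sum_orbital_add_sum_central_add_sum_singular_add_sum_hyperbolic_cm` (`flag = true`,
`p = (X − a)²(X − b) ⊗ 𝔸_E`, `c a·a = c b·b = 1`, `a ≠ b`), then `(a, b)` is such a key — the `hpq` letter of ★ KEYED GLUE.
[cite: Rogawski1990, §2.2 (p. 13)] [cite: Rogawski1990, §7.2 (pp. 91–92)] -/
theorem exists_units_of_mem_filter_singular (S : Finset ((AdeleRing (𝓞 E) E)[X] × Bool))
    (i : (AdeleRing (𝓞 E) E)[X] × Bool) (_hi : i ∈ S)
    (hpi : (fun i : (AdeleRing (𝓞 E) E)[X] × Bool => i.2 = true ∧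
        ∃ a b : Eˣ, c (a : E) * (a : E) = 1 ∧ c (b : E) * (b : E) = 1 ∧
          (a : E) ≠ (b : E) ∧ i.1 = ((X - C (a : E)) ^ 2 * (X - C (b : E))).map (algebraMap E (AdeleRing (𝓞 E) E))) i) :
    ∃ k : Eˣ × Eˣ, (c ((k.1 : Eˣ) : E) * ((k.1 : Eˣ) : E) = 1 ∧ c ((k.2 : Eˣ) : E) * ((k.2 : Eˣ) : E) = 1 ∧
        ((k.1 : Eˣ) : E) ≠ ((k.2 : Eˣ) : E)) ∧
      ((((X - C ((k.1 : Eˣ) : E)) ^ 2 * (X - C ((k.2 : Eˣ) : E))).map (algebraMap E (AdeleRing (𝓞 E) E))), true) = i := by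
  obtain ⟨hi2, a, b, ha, hb, hab, hi1⟩ := hpi
  exact ⟨(a, b), ⟨ha, hb, hab⟩, Prod.ext hi1.symm hi2.symm⟩

/-- **THE SINGULAR DIAGONAL `d(a, b, a)` IS A RATIONAL POINT** of the quasi-split `U(J₃)` for `a, b ∈ E¹` — ★
`exists_rational_eq_singularNormalForm` at `w = 0`. [cite: Rogawski1990, §7.2 (pp. 91–92)] -/
theorem exists_rational_eq_singularDiagonal {a b : Eˣ} (ha : c (a : E) * (a : E) = 1) (hb : c (b : E) * (b : E) = 1) :
    ∃ g : (quasiSplit F E c 3).Rational,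
      ((g.1 : GL (Fin 3) E) : Matrix (Fin 3) (Fin 3) E) = !![(a : E), 0, 0; 0, b, 0; 0, 0, a] := by
  obtain ⟨g, hg⟩ := exists_rational_eq_singularNormalForm (F := F) ha hb (w := 0) (by rw [map_zero, add_zero])
  exact ⟨g, by rw [hg, mul_zero]⟩

/-- Packaging `∃ A B, Q A B` as ONE pair `e = (A, B)` with a trivial side condition: `∃ e, True ∧ Q e.1 e.2` — the shape ★ KEYED
GLUE's `_const` lemma consumes. [folklore] -/
private theorem exists_prod_true_of_exists₂ {α β : Type*} {Q : α → β → Prop} (h : ∃ a b, Q a b) :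
    ∃ e : α × β, True ∧ Q e.1 e.2 := by
  obtain ⟨a, b, hQ⟩ := h
  exact ⟨(a, b), trivial, hQ⟩

end Key

/-! ## §2 The singular socket closed at the CM pin -/

section CM

/-- **THE SINGULAR SOCKET, CLOSED ON A FINITE SET OF CLASSES (CM pin)** [Rogawski1990, Prop. 7.2.2, (7.2.3)]. At the CM pair
`(L⁺, L, complexConj)`, for a test function `f`, an automorphic measure `μ`, the quadratic data `δ, θ₀` of ★
`truncatedTraceClass_singular_eq_mul_log_add_cm`, the integrability `hS` of the orbital sums of the singular diagonals (uniform over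
the keys), a finite set `S` of refined indices and class polynomials `P` with `J^T_i(f) = P_i(log T)` for `T ≫ 0` (`i ∈ S`; the
socket's letter `hP`): there are keys `srep i = (a, b)` and constants `cst i = (𝔄, 𝔅)` such that on the singular filter
`c a·a = c b·b = 1`, `a ≠ b`, `(((X − a)²(X − b)) ⊗ 𝔸_L, true) = i`, `P i = C 𝔄 * X + C 𝔅` and `Σ_{S.filter singular} P_i(0) = Σ 𝔅`.
★ KEYED GLUE `exists_rep_const_sum_classPolynomial_eval_zero_eq` ∘ ★ `truncatedTraceClass_singular_eq_mul_log_add_cm` ∘ ★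
`exists_rational_eq_singularNormalForm`. [cite: Rogawski1990, Prop. 7.2.2 (pp. 91–95)] [cite: Arthur1981TraceFormulaInvariantForm, Prop. 2.3] -/
theorem exists_rep_sum_filter_singular_classPolynomial_eval_zero_cm (L : Type) [Field L] [NumberField L] [IsCMField L]
    [MeasurableSpace (AdeleRing (𝓞 L) L)] [BorelSpace (AdeleRing (𝓞 L) L)]
    [MeasurableSpace (adelicUnipotent (↥(maximalRealSubfield L)) L (IsCMField.complexConj L) 3)]
    [BorelSpace (adelicUnipotent (↥(maximalRealSubfield L)) L (IsCMField.complexConj L) 3)]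
    [MeasurableSpace (quasiSplit (↥(maximalRealSubfield L)) L (IsCMField.complexConj L) 3).Adelic]
    [BorelSpace (quasiSplit (↥(maximalRealSubfield L)) L (IsCMField.complexConj L) 3).Adelic]
    {δ : L} (hcδ : (IsCMField.complexConj L) δ = -δ) (hδ : δ ≠ 0) (θ₀ : 𝓞 (↥(maximalRealSubfield L))) (hθ : θ₀ ≠ 0)
    (hd : δ * δ = algebraMap (↥(maximalRealSubfield L)) L (θ₀ : (↥(maximalRealSubfield L))))
    (ν : Measure (adelicUnipotent (↥(maximalRealSubfield L)) L (IsCMField.complexConj L) 3)) [ν.IsHaarMeasure]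
    {𝓕 : Set (adelicUnipotent (↥(maximalRealSubfield L)) L (IsCMField.complexConj L) 3)} (h𝓕 : IsFundamentalDomain (rationalUnipotent (↥(maximalRealSubfield L)) L (IsCMField.complexConj L) 3) 𝓕 ν)
    (μ : Measure (quasiSplit (↥(maximalRealSubfield L)) L (IsCMField.complexConj L) 3).automorphicQuotient) [(quasiSplit (↥(maximalRealSubfield L)) L (IsCMField.complexConj L) 3).IsAutomorphicMeasure μ]
    {f : (quasiSplit (↥(maximalRealSubfield L)) L (IsCMField.complexConj L) 3).Adelic → ℂ} (hf : IsQuasiSplitTest (↥(maximalRealSubfield L)) L (IsCMField.complexConj L) 3 f)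
    (hS : ∀ (a b : Lˣ) (g₀ : (quasiSplit (↥(maximalRealSubfield L)) L (IsCMField.complexConj L) 3).Rational), (IsCMField.complexConj L) (a : L) * (a : L) = 1 → (IsCMField.complexConj L) (b : L) * (b : L) = 1 →
      (a : L) ≠ (b : L) → ((g₀.val : GL (Fin 3) L) : Matrix (Fin 3) (Fin 3) L) = !![(a : L), 0, 0; 0, b, 0; 0, 0, a] →
      Integrable ((quasiSplit (↥(maximalRealSubfield L)) L (IsCMField.complexConj L) 3).quotFun (fun y : (quasiSplit (↥(maximalRealSubfield L)) L (IsCMField.complexConj L) 3).Adelic =>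
        ∑' s : ↥(conjOrbit (quasiSplit (↥(maximalRealSubfield L)) L (IsCMField.complexConj L) 3).arithmeticSubgroup ((quasiSplit (↥(maximalRealSubfield L)) L (IsCMField.complexConj L) 3).toAdelic g₀)),
          f (y⁻¹ * (s : (quasiSplit (↥(maximalRealSubfield L)) L (IsCMField.complexConj L) 3).Adelic) * y))) μ)
    (S : Finset ((AdeleRing (𝓞 L) L)[X] × Bool)) (P : (AdeleRing (𝓞 L) L)[X] × Bool → ℂ[X])
    (hP : ∀ i ∈ S, ∃ T₀ : ℝ≥0, ∀ T : ℝ≥0, T₀ < T →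
      truncatedTraceClass μ ν 𝓕 T
          (fun γ : (quasiSplit (↥(maximalRealSubfield L)) L (IsCMField.complexConj L) 3).arithmeticSubgroup =>
            (((adelicVal (↥(maximalRealSubfield L)) L (IsCMField.complexConj L) 3 _
                (γ : (quasiSplit (↥(maximalRealSubfield L)) L (IsCMField.complexConj L) 3).Adelic) :
                GL (Fin 3) (AdeleRing (𝓞 L) L)) : Matrix (Fin 3) (Fin 3) (AdeleRing (𝓞 L) L)).charpoly,
              decide (∃ δ : (quasiSplit (↥(maximalRealSubfield L)) L (IsCMField.complexConj L) 3).arithmeticSubgroup,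
                δ * γ * δ⁻¹ ∈ arithmeticBorel (↥(maximalRealSubfield L)) L (IsCMField.complexConj L) 3)))
          i f = (P i).eval ((Real.log (T : ℝ) : ℝ) : ℂ)) :
    ∃ (srep : (AdeleRing (𝓞 L) L)[X] × Bool → Lˣ × Lˣ) (cst : (AdeleRing (𝓞 L) L)[X] × Bool → ℂ × ℂ),
      (∀ i ∈ S.filter (fun i : (AdeleRing (𝓞 L) L)[X] × Bool => i.2 = true ∧
        ∃ a b : Lˣ, (IsCMField.complexConj L) (a : L) * (a : L) = 1 ∧ (IsCMField.complexConj L) (b : L) * (b : L) = 1 ∧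
          (a : L) ≠ (b : L) ∧ i.1 = ((X - C (a : L)) ^ 2 * (X - C (b : L))).map (algebraMap L (AdeleRing (𝓞 L) L))),
        ((IsCMField.complexConj L) (((srep i).1 : Lˣ) : L) * (((srep i).1 : Lˣ) : L) = 1 ∧
            (IsCMField.complexConj L) (((srep i).2 : Lˣ) : L) * (((srep i).2 : Lˣ) : L) = 1 ∧
            (((srep i).1 : Lˣ) : L) ≠ (((srep i).2 : Lˣ) : L)) ∧
          ((((X - C (((srep i).1 : Lˣ) : L)) ^ 2 * (X - C (((srep i).2 : Lˣ) : L))).map (algebraMap L (AdeleRing (𝓞 L) L))), true) = i) ∧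
      (∀ i ∈ S.filter (fun i : (AdeleRing (𝓞 L) L)[X] × Bool => i.2 = true ∧
        ∃ a b : Lˣ, (IsCMField.complexConj L) (a : L) * (a : L) = 1 ∧ (IsCMField.complexConj L) (b : L) * (b : L) = 1 ∧
          (a : L) ≠ (b : L) ∧ i.1 = ((X - C (a : L)) ^ 2 * (X - C (b : L))).map (algebraMap L (AdeleRing (𝓞 L) L))),
        P i = C (cst i).1 * X + C (cst i).2) ∧
      ∑ i ∈ S.filter (fun i : (AdeleRing (𝓞 L) L)[X] × Bool => i.2 = true ∧
        ∃ a b : Lˣ, (IsCMField.complexConj L) (a : L) * (a : L) = 1 ∧ (IsCMField.complexConj L) (b : L) * (b : L) = 1 ∧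
          (a : L) ≠ (b : L) ∧ i.1 = ((X - C (a : L)) ^ 2 * (X - C (b : L))).map (algebraMap L (AdeleRing (𝓞 L) L))), (P i).eval 0 =
        ∑ i ∈ S.filter (fun i : (AdeleRing (𝓞 L) L)[X] × Bool => i.2 = true ∧
        ∃ a b : Lˣ, (IsCMField.complexConj L) (a : L) * (a : L) = 1 ∧ (IsCMField.complexConj L) (b : L) * (b : L) = 1 ∧
          (a : L) ≠ (b : L) ∧ i.1 = ((X - C (a : L)) ^ 2 * (X - C (b : L))).map (algebraMap L (AdeleRing (𝓞 L) L))), (cst i).2 := by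
  -- the per-key row closer: ★ `truncatedTraceClass_singular_eq_mul_log_add_cm` at `g₀ := d(a, b, a)`, `γ₀ := ι(g₀)`,
  -- its constants `(𝔄, 𝔅)` packaged as one `e : ℂ × ℂ` (read off as the letters `a`, `b` of ★ KEYED GLUE by unification)
  have hrow : ∀ k : Lˣ × Lˣ, ((IsCMField.complexConj L) ((k.1 : Lˣ) : L) * ((k.1 : Lˣ) : L) = 1 ∧
      (IsCMField.complexConj L) ((k.2 : Lˣ) : L) * ((k.2 : Lˣ) : L) = 1 ∧ ((k.1 : Lˣ) : L) ≠ ((k.2 : Lˣ) : L)) →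
      ∃ e : ℂ × ℂ, True ∧ ∃ T₀ : ℝ≥0, ∀ T : ℝ≥0, T₀ < T →
        truncatedTraceClass μ ν 𝓕 T
          (fun γ : (quasiSplit (↥(maximalRealSubfield L)) L (IsCMField.complexConj L) 3).arithmeticSubgroup =>
            (((adelicVal (↥(maximalRealSubfield L)) L (IsCMField.complexConj L) 3 _
                (γ : (quasiSplit (↥(maximalRealSubfield L)) L (IsCMField.complexConj L) 3).Adelic) :
                GL (Fin 3) (AdeleRing (𝓞 L) L)) : Matrix (Fin 3) (Fin 3) (AdeleRing (𝓞 L) L)).charpoly,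
              decide (∃ δ : (quasiSplit (↥(maximalRealSubfield L)) L (IsCMField.complexConj L) 3).arithmeticSubgroup,
                δ * γ * δ⁻¹ ∈ arithmeticBorel (↥(maximalRealSubfield L)) L (IsCMField.complexConj L) 3)))
          ((((X - C ((k.1 : Lˣ) : L)) ^ 2 * (X - C ((k.2 : Lˣ) : L))).map (algebraMap L (AdeleRing (𝓞 L) L))), true) f = e.1 * ((Real.log (T : ℝ) : ℝ) : ℂ) + e.2 := by
    intro k hk
    obtain ⟨g₀, hg₀⟩ := exists_rational_eq_singularDiagonal (F := (↥(maximalRealSubfield L))) (c := (IsCMField.complexConj L)) hk.1 hk.2.1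
    exact exists_prod_true_of_exists₂ (truncatedTraceClass_singular_eq_mul_log_add_cm L (complexConj_mul_complexConj L)
      (γ₀ := ⟨(quasiSplit (↥(maximalRealSubfield L)) L (IsCMField.complexConj L) 3).toAdelic g₀, g₀, rfl⟩) hg₀ rfl hk.2.2 hk.1 hk.2.1 hcδ hδ θ₀ hθ hd ν h𝓕 μ hf
      (hS k.1 k.2 g₀ hk.1 hk.2.1 hk.2.2 hg₀))
  obtain ⟨rep, cst, hkey, hlin, hsum⟩ := exists_rep_const_sum_classPolynomial_eval_zero_eq S
    (fun i : (AdeleRing (𝓞 L) L)[X] × Bool => i.2 = true ∧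
        ∃ a b : Lˣ, (IsCMField.complexConj L) (a : L) * (a : L) = 1 ∧ (IsCMField.complexConj L) (b : L) * (b : L) = 1 ∧
          (a : L) ≠ (b : L) ∧ i.1 = ((X - C (a : L)) ^ 2 * (X - C (b : L))).map (algebraMap L (AdeleRing (𝓞 L) L)))
    (fun k : Lˣ × Lˣ => ((((X - C ((k.1 : Lˣ) : L)) ^ 2 * (X - C ((k.2 : Lˣ) : L))).map (algebraMap L (AdeleRing (𝓞 L) L))), true))
    (fun k : Lˣ × Lˣ => (IsCMField.complexConj L) ((k.1 : Lˣ) : L) * ((k.1 : Lˣ) : L) = 1 ∧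
      (IsCMField.complexConj L) ((k.2 : Lˣ) : L) * ((k.2 : Lˣ) : L) = 1 ∧ ((k.1 : Lˣ) : L) ≠ ((k.2 : Lˣ) : L))
    (fun i hi hpi => exists_units_of_mem_filter_singular S i hi hpi)
    (fun (_ : Lˣ × Lˣ) (_ : ℂ × ℂ) => True) hrow P hP
  exact ⟨rep, cst, fun i hi => ⟨(hkey i hi).1, (hkey i hi).2.1⟩, hlin, hsum⟩

/-! ## §3 The `closerS` letter of the (L5-ω) skeleton: key and constants packed in ONE product key -/

/-- **THE SINGULAR SOCKET CLOSED, IN THE SHAPE OF THE `closerS` HYPOTHESIS** of ★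
`arthurTrace_eq_orbital_add_central_add_singular_add_hyperbolic_of_closers` (`UnitaryGroupArthurTraceThreeSocketsClosed`) at the
product key type `κs := (Lˣ × Lˣ) × (ℂ × ℂ)` with `Bs p := p.2.2`: for `S`, `P`, `hP` as in §2 there is `srep : _ → κs` with
`Σ_{S.filter singular} P_i(0) = Σ_{S.filter singular} (srep i).2.2`. Dock:
`closerS := exists_keyrep_sum_filter_singular_classPolynomial_eval_zero_cm L hcδ hδ θ₀ hθ hd ν h𝓕 μ hf hS`.
[cite: Rogawski1990, Prop. 7.2.2 (pp. 91–95)] [cite: Arthur1981TraceFormulaInvariantForm, Prop. 2.3] -/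
theorem exists_keyrep_sum_filter_singular_classPolynomial_eval_zero_cm (L : Type) [Field L] [NumberField L] [IsCMField L]
    [MeasurableSpace (AdeleRing (𝓞 L) L)] [BorelSpace (AdeleRing (𝓞 L) L)]
    [MeasurableSpace (adelicUnipotent (↥(maximalRealSubfield L)) L (IsCMField.complexConj L) 3)]
    [BorelSpace (adelicUnipotent (↥(maximalRealSubfield L)) L (IsCMField.complexConj L) 3)]
    [MeasurableSpace (quasiSplit (↥(maximalRealSubfield L)) L (IsCMField.complexConj L) 3).Adelic]
    [BorelSpace (quasiSplit (↥(maximalRealSubfield L)) L (IsCMField.complexConj L) 3).Adelic]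
    {δ : L} (hcδ : (IsCMField.complexConj L) δ = -δ) (hδ : δ ≠ 0) (θ₀ : 𝓞 (↥(maximalRealSubfield L))) (hθ : θ₀ ≠ 0)
    (hd : δ * δ = algebraMap (↥(maximalRealSubfield L)) L (θ₀ : (↥(maximalRealSubfield L))))
    (ν : Measure (adelicUnipotent (↥(maximalRealSubfield L)) L (IsCMField.complexConj L) 3)) [ν.IsHaarMeasure]
    {𝓕 : Set (adelicUnipotent (↥(maximalRealSubfield L)) L (IsCMField.complexConj L) 3)} (h𝓕 : IsFundamentalDomain (rationalUnipotent (↥(maximalRealSubfield L)) L (IsCMField.complexConj L) 3) 𝓕 ν)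
    (μ : Measure (quasiSplit (↥(maximalRealSubfield L)) L (IsCMField.complexConj L) 3).automorphicQuotient) [(quasiSplit (↥(maximalRealSubfield L)) L (IsCMField.complexConj L) 3).IsAutomorphicMeasure μ]
    {f : (quasiSplit (↥(maximalRealSubfield L)) L (IsCMField.complexConj L) 3).Adelic → ℂ} (hf : IsQuasiSplitTest (↥(maximalRealSubfield L)) L (IsCMField.complexConj L) 3 f)
    (hS : ∀ (a b : Lˣ) (g₀ : (quasiSplit (↥(maximalRealSubfield L)) L (IsCMField.complexConj L) 3).Rational), (IsCMField.complexConj L) (a : L) * (a : L) = 1 → (IsCMField.complexConj L) (b : L) * (b : L) = 1 →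
      (a : L) ≠ (b : L) → ((g₀.val : GL (Fin 3) L) : Matrix (Fin 3) (Fin 3) L) = !![(a : L), 0, 0; 0, b, 0; 0, 0, a] →
      Integrable ((quasiSplit (↥(maximalRealSubfield L)) L (IsCMField.complexConj L) 3).quotFun (fun y : (quasiSplit (↥(maximalRealSubfield L)) L (IsCMField.complexConj L) 3).Adelic =>
        ∑' s : ↥(conjOrbit (quasiSplit (↥(maximalRealSubfield L)) L (IsCMField.complexConj L) 3).arithmeticSubgroup ((quasiSplit (↥(maximalRealSubfield L)) L (IsCMField.complexConj L) 3).toAdelic g₀)),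
          f (y⁻¹ * (s : (quasiSplit (↥(maximalRealSubfield L)) L (IsCMField.complexConj L) 3).Adelic) * y))) μ)
    (S : Finset ((AdeleRing (𝓞 L) L)[X] × Bool)) (P : (AdeleRing (𝓞 L) L)[X] × Bool → ℂ[X])
    (hP : ∀ i ∈ S, ∃ T₀ : ℝ≥0, ∀ T : ℝ≥0, T₀ < T →
      truncatedTraceClass μ ν 𝓕 T
          (fun γ : (quasiSplit (↥(maximalRealSubfield L)) L (IsCMField.complexConj L) 3).arithmeticSubgroup =>
            (((adelicVal (↥(maximalRealSubfield L)) L (IsCMField.complexConj L) 3 _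
                (γ : (quasiSplit (↥(maximalRealSubfield L)) L (IsCMField.complexConj L) 3).Adelic) :
                GL (Fin 3) (AdeleRing (𝓞 L) L)) : Matrix (Fin 3) (Fin 3) (AdeleRing (𝓞 L) L)).charpoly,
              decide (∃ δ : (quasiSplit (↥(maximalRealSubfield L)) L (IsCMField.complexConj L) 3).arithmeticSubgroup,
                δ * γ * δ⁻¹ ∈ arithmeticBorel (↥(maximalRealSubfield L)) L (IsCMField.complexConj L) 3)))
          i f = (P i).eval ((Real.log (T : ℝ) : ℝ) : ℂ)) :
    ∃ srep : (AdeleRing (𝓞 L) L)[X] × Bool → (Lˣ × Lˣ) × (ℂ × ℂ),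
      ∑ i ∈ S.filter (fun i : (AdeleRing (𝓞 L) L)[X] × Bool => i.2 = true ∧
        ∃ a b : Lˣ, (IsCMField.complexConj L) (a : L) * (a : L) = 1 ∧ (IsCMField.complexConj L) (b : L) * (b : L) = 1 ∧
          (a : L) ≠ (b : L) ∧ i.1 = ((X - C (a : L)) ^ 2 * (X - C (b : L))).map (algebraMap L (AdeleRing (𝓞 L) L))), (P i).eval 0 =
        ∑ i ∈ S.filter (fun i : (AdeleRing (𝓞 L) L)[X] × Bool => i.2 = true ∧
        ∃ a b : Lˣ, (IsCMField.complexConj L) (a : L) * (a : L) = 1 ∧ (IsCMField.complexConj L) (b : L) * (b : L) = 1 ∧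
          (a : L) ≠ (b : L) ∧ i.1 = ((X - C (a : L)) ^ 2 * (X - C (b : L))).map (algebraMap L (AdeleRing (𝓞 L) L))), (srep i).2.2 := by
  have h := exists_rep_sum_filter_singular_classPolynomial_eval_zero_cm L hcδ hδ θ₀ hθ hd ν h𝓕 μ hf hS S P hP
  cases h with
  | intro srep h1 =>
    cases h1 with
    | intro cst h2 => exact ⟨fun i => (srep i, cst i), h2.2.2⟩

/-! ## §4 (ED. 2) The singular socket closed WITHOUT the integrability letter `hS`

★ `integrable_quotFun_tsum_conjOrbit_singular_cm` (`UnitaryGroupSingularOrbitalTermCM`): for a singular diagonal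
`g₀ = d(a, b, a)`, `a ≠ b ∈ L¹`, and a quasi-split test function `f`, the orbital sum `y ↦ Σ'_{s ∈ 𝒪(ι g₀)} f(y⁻¹ s y)` descends to an
integrable function on `X = G(F)\G(𝔸)` for every automorphic measure — Rogawski Prop. 7.2.1 (`γ₀` is singular semisimple,
`G_γ₀ ≅ U(1,1) × U(1)` has finite covolume `vol(G_γ₀(F)\G_γ₀(𝔸)) < ∞` and the orbital integral over `G_γ₀(𝔸)\G(𝔸)` converges for
`f ∈ C_c^∞`). So the uniform letter `hS` of §2–§3 is DISCHARGED and the closer is analytic-hypothesis-free. -/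

/-- **THE SINGULAR SOCKET, CLOSED ON A FINITE SET OF CLASSES (CM pin), NO `hS`** — §2
`exists_rep_sum_filter_singular_classPolynomial_eval_zero_cm` with its integrability letter `hS` discharged by ★
`integrable_quotFun_tsum_conjOrbit_singular_cm` at `γ₀ := ι(g₀)`: keys `srep i = (a, b)` and constants `cst i = (𝔄, 𝔅)` on the
singular filter with `c a·a = c b·b = 1`, `a ≠ b`, `(((X − a)²(X − b)) ⊗ 𝔸_L, true) = i`, `P i = C 𝔄 * X + C 𝔅` and
`Σ_{S.filter singular} P_i(0) = Σ 𝔅`. [cite: Rogawski1990, Prop. 7.2.1, Prop. 7.2.2 (pp. 91–95)]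
[cite: Arthur1981TraceFormulaInvariantForm, Prop. 2.3] -/
theorem exists_rep_sum_filter_singular_classPolynomial_eval_zero_cm' (L : Type) [Field L] [NumberField L] [IsCMField L]
    [MeasurableSpace (AdeleRing (𝓞 L) L)] [BorelSpace (AdeleRing (𝓞 L) L)]
    [MeasurableSpace (adelicUnipotent (↥(maximalRealSubfield L)) L (IsCMField.complexConj L) 3)]
    [BorelSpace (adelicUnipotent (↥(maximalRealSubfield L)) L (IsCMField.complexConj L) 3)]
    [MeasurableSpace (quasiSplit (↥(maximalRealSubfield L)) L (IsCMField.complexConj L) 3).Adelic]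
    [BorelSpace (quasiSplit (↥(maximalRealSubfield L)) L (IsCMField.complexConj L) 3).Adelic]
    {δ : L} (hcδ : (IsCMField.complexConj L) δ = -δ) (hδ : δ ≠ 0) (θ₀ : 𝓞 (↥(maximalRealSubfield L))) (hθ : θ₀ ≠ 0)
    (hd : δ * δ = algebraMap (↥(maximalRealSubfield L)) L (θ₀ : (↥(maximalRealSubfield L))))
    (ν : Measure (adelicUnipotent (↥(maximalRealSubfield L)) L (IsCMField.complexConj L) 3)) [ν.IsHaarMeasure]
    {𝓕 : Set (adelicUnipotent (↥(maximalRealSubfield L)) L (IsCMField.complexConj L) 3)} (h𝓕 : IsFundamentalDomain (rationalUnipotent (↥(maximalRealSubfield L)) L (IsCMField.complexConj L) 3) 𝓕 ν)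
    (μ : Measure (quasiSplit (↥(maximalRealSubfield L)) L (IsCMField.complexConj L) 3).automorphicQuotient) [(quasiSplit (↥(maximalRealSubfield L)) L (IsCMField.complexConj L) 3).IsAutomorphicMeasure μ]
    {f : (quasiSplit (↥(maximalRealSubfield L)) L (IsCMField.complexConj L) 3).Adelic → ℂ} (hf : IsQuasiSplitTest (↥(maximalRealSubfield L)) L (IsCMField.complexConj L) 3 f)
    (S : Finset ((AdeleRing (𝓞 L) L)[X] × Bool)) (P : (AdeleRing (𝓞 L) L)[X] × Bool → ℂ[X])
    (hP : ∀ i ∈ S, ∃ T₀ : ℝ≥0, ∀ T : ℝ≥0, T₀ < T →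
      truncatedTraceClass μ ν 𝓕 T
          (fun γ : (quasiSplit (↥(maximalRealSubfield L)) L (IsCMField.complexConj L) 3).arithmeticSubgroup =>
            (((adelicVal (↥(maximalRealSubfield L)) L (IsCMField.complexConj L) 3 _
                (γ : (quasiSplit (↥(maximalRealSubfield L)) L (IsCMField.complexConj L) 3).Adelic) :
                GL (Fin 3) (AdeleRing (𝓞 L) L)) : Matrix (Fin 3) (Fin 3) (AdeleRing (𝓞 L) L)).charpoly,
              decide (∃ δ : (quasiSplit (↥(maximalRealSubfield L)) L (IsCMField.complexConj L) 3).arithmeticSubgroup,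
                δ * γ * δ⁻¹ ∈ arithmeticBorel (↥(maximalRealSubfield L)) L (IsCMField.complexConj L) 3)))
          i f = (P i).eval ((Real.log (T : ℝ) : ℝ) : ℂ)) :
    ∃ (srep : (AdeleRing (𝓞 L) L)[X] × Bool → Lˣ × Lˣ) (cst : (AdeleRing (𝓞 L) L)[X] × Bool → ℂ × ℂ),
      (∀ i ∈ S.filter (fun i : (AdeleRing (𝓞 L) L)[X] × Bool => i.2 = true ∧
        ∃ a b : Lˣ, (IsCMField.complexConj L) (a : L) * (a : L) = 1 ∧ (IsCMField.complexConj L) (b : L) * (b : L) = 1 ∧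
          (a : L) ≠ (b : L) ∧ i.1 = ((X - C (a : L)) ^ 2 * (X - C (b : L))).map (algebraMap L (AdeleRing (𝓞 L) L))),
        ((IsCMField.complexConj L) (((srep i).1 : Lˣ) : L) * (((srep i).1 : Lˣ) : L) = 1 ∧
            (IsCMField.complexConj L) (((srep i).2 : Lˣ) : L) * (((srep i).2 : Lˣ) : L) = 1 ∧
            (((srep i).1 : Lˣ) : L) ≠ (((srep i).2 : Lˣ) : L)) ∧
          ((((X - C (((srep i).1 : Lˣ) : L)) ^ 2 * (X - C (((srep i).2 : Lˣ) : L))).map (algebraMap L (AdeleRing (𝓞 L) L))), true) = i) ∧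
      (∀ i ∈ S.filter (fun i : (AdeleRing (𝓞 L) L)[X] × Bool => i.2 = true ∧
        ∃ a b : Lˣ, (IsCMField.complexConj L) (a : L) * (a : L) = 1 ∧ (IsCMField.complexConj L) (b : L) * (b : L) = 1 ∧
          (a : L) ≠ (b : L) ∧ i.1 = ((X - C (a : L)) ^ 2 * (X - C (b : L))).map (algebraMap L (AdeleRing (𝓞 L) L))),
        P i = C (cst i).1 * X + C (cst i).2) ∧
      ∑ i ∈ S.filter (fun i : (AdeleRing (𝓞 L) L)[X] × Bool => i.2 = true ∧
        ∃ a b : Lˣ, (IsCMField.complexConj L) (a : L) * (a : L) = 1 ∧ (IsCMField.complexConj L) (b : L) * (b : L) = 1 ∧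
          (a : L) ≠ (b : L) ∧ i.1 = ((X - C (a : L)) ^ 2 * (X - C (b : L))).map (algebraMap L (AdeleRing (𝓞 L) L))), (P i).eval 0 =
        ∑ i ∈ S.filter (fun i : (AdeleRing (𝓞 L) L)[X] × Bool => i.2 = true ∧
        ∃ a b : Lˣ, (IsCMField.complexConj L) (a : L) * (a : L) = 1 ∧ (IsCMField.complexConj L) (b : L) * (b : L) = 1 ∧
          (a : L) ≠ (b : L) ∧ i.1 = ((X - C (a : L)) ^ 2 * (X - C (b : L))).map (algebraMap L (AdeleRing (𝓞 L) L))), (cst i).2 :=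
  exists_rep_sum_filter_singular_classPolynomial_eval_zero_cm L hcδ hδ θ₀ hθ hd ν h𝓕 μ hf
    (fun _ _ g₀ _ _ hab hg₀ => integrable_quotFun_tsum_conjOrbit_singular_cm L
      (γ₀ := ⟨(quasiSplit (↥(maximalRealSubfield L)) L (IsCMField.complexConj L) 3).toAdelic g₀, g₀, rfl⟩) hg₀ rfl hab μ hf) S P hP

/-- **THE SINGULAR SOCKET CLOSED IN THE SHAPE OF THE `closerS` HYPOTHESIS, NO `hS`** of ★
`arthurTrace_eq_orbital_add_central_add_singular_add_hyperbolic_of_closers` (`UnitaryGroupArthurTraceThreeSocketsClosed`) at the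
product key type `κs := (Lˣ × Lˣ) × (ℂ × ℂ)` with `Bs p := p.2.2` — §3 with `hS` discharged by ★
`integrable_quotFun_tsum_conjOrbit_singular_cm`. Dock (no analytic hypothesis left):
`closerS := exists_keyrep_sum_filter_singular_classPolynomial_eval_zero_cm' L hcδ hδ θ₀ hθ hd ν h𝓕 μ hf`.
[cite: Rogawski1990, Prop. 7.2.1, Prop. 7.2.2 (pp. 91–95)] [cite: Arthur1981TraceFormulaInvariantForm, Prop. 2.3] -/
theorem exists_keyrep_sum_filter_singular_classPolynomial_eval_zero_cm' (L : Type) [Field L] [NumberField L] [IsCMField L]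
    [MeasurableSpace (AdeleRing (𝓞 L) L)] [BorelSpace (AdeleRing (𝓞 L) L)]
    [MeasurableSpace (adelicUnipotent (↥(maximalRealSubfield L)) L (IsCMField.complexConj L) 3)]
    [BorelSpace (adelicUnipotent (↥(maximalRealSubfield L)) L (IsCMField.complexConj L) 3)]
    [MeasurableSpace (quasiSplit (↥(maximalRealSubfield L)) L (IsCMField.complexConj L) 3).Adelic]
    [BorelSpace (quasiSplit (↥(maximalRealSubfield L)) L (IsCMField.complexConj L) 3).Adelic]
    {δ : L} (hcδ : (IsCMField.complexConj L) δ = -δ) (hδ : δ ≠ 0) (θ₀ : 𝓞 (↥(maximalRealSubfield L))) (hθ : θ₀ ≠ 0)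
    (hd : δ * δ = algebraMap (↥(maximalRealSubfield L)) L (θ₀ : (↥(maximalRealSubfield L))))
    (ν : Measure (adelicUnipotent (↥(maximalRealSubfield L)) L (IsCMField.complexConj L) 3)) [ν.IsHaarMeasure]
    {𝓕 : Set (adelicUnipotent (↥(maximalRealSubfield L)) L (IsCMField.complexConj L) 3)} (h𝓕 : IsFundamentalDomain (rationalUnipotent (↥(maximalRealSubfield L)) L (IsCMField.complexConj L) 3) 𝓕 ν)
    (μ : Measure (quasiSplit (↥(maximalRealSubfield L)) L (IsCMField.complexConj L) 3).automorphicQuotient) [(quasiSplit (↥(maximalRealSubfield L)) L (IsCMField.complexConj L) 3).IsAutomorphicMeasure μ]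
    {f : (quasiSplit (↥(maximalRealSubfield L)) L (IsCMField.complexConj L) 3).Adelic → ℂ} (hf : IsQuasiSplitTest (↥(maximalRealSubfield L)) L (IsCMField.complexConj L) 3 f)
    (S : Finset ((AdeleRing (𝓞 L) L)[X] × Bool)) (P : (AdeleRing (𝓞 L) L)[X] × Bool → ℂ[X])
    (hP : ∀ i ∈ S, ∃ T₀ : ℝ≥0, ∀ T : ℝ≥0, T₀ < T →
      truncatedTraceClass μ ν 𝓕 T
          (fun γ : (quasiSplit (↥(maximalRealSubfield L)) L (IsCMField.complexConj L) 3).arithmeticSubgroup =>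
            (((adelicVal (↥(maximalRealSubfield L)) L (IsCMField.complexConj L) 3 _
                (γ : (quasiSplit (↥(maximalRealSubfield L)) L (IsCMField.complexConj L) 3).Adelic) :
                GL (Fin 3) (AdeleRing (𝓞 L) L)) : Matrix (Fin 3) (Fin 3) (AdeleRing (𝓞 L) L)).charpoly,
              decide (∃ δ : (quasiSplit (↥(maximalRealSubfield L)) L (IsCMField.complexConj L) 3).arithmeticSubgroup,
                δ * γ * δ⁻¹ ∈ arithmeticBorel (↥(maximalRealSubfield L)) L (IsCMField.complexConj L) 3)))
          i f = (P i).eval ((Real.log (T : ℝ) : ℝ) : ℂ)) :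
    ∃ srep : (AdeleRing (𝓞 L) L)[X] × Bool → (Lˣ × Lˣ) × (ℂ × ℂ),
      ∑ i ∈ S.filter (fun i : (AdeleRing (𝓞 L) L)[X] × Bool => i.2 = true ∧
        ∃ a b : Lˣ, (IsCMField.complexConj L) (a : L) * (a : L) = 1 ∧ (IsCMField.complexConj L) (b : L) * (b : L) = 1 ∧
          (a : L) ≠ (b : L) ∧ i.1 = ((X - C (a : L)) ^ 2 * (X - C (b : L))).map (algebraMap L (AdeleRing (𝓞 L) L))), (P i).eval 0 =
        ∑ i ∈ S.filter (fun i : (AdeleRing (𝓞 L) L)[X] × Bool => i.2 = true ∧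
        ∃ a b : Lˣ, (IsCMField.complexConj L) (a : L) * (a : L) = 1 ∧ (IsCMField.complexConj L) (b : L) * (b : L) = 1 ∧
          (a : L) ≠ (b : L) ∧ i.1 = ((X - C (a : L)) ^ 2 * (X - C (b : L))).map (algebraMap L (AdeleRing (𝓞 L) L))), (srep i).2.2 :=
  exists_keyrep_sum_filter_singular_classPolynomial_eval_zero_cm L hcδ hδ θ₀ hθ hd ν h𝓕 μ hf
    (fun _ _ g₀ _ _ hab hg₀ => integrable_quotFun_tsum_conjOrbit_singular_cm L
      (γ₀ := ⟨(quasiSplit (↥(maximalRealSubfield L)) L (IsCMField.complexConj L) 3).toAdelic g₀, g₀, rfl⟩) hg₀ rfl hab μ hf) S P hP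

end CM

end UnitaryGroup

end Literature.NumberTheory.Automorphic
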